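import Mathlib
import HarnessLib
import Summits.NavierStokesRegularity.NavierStokesRegularity.Theorems.TaylorModelRungThreeCertificateReadoutVLand

/-!
# Crux K1b-DR (stmt-NavierStokesRegularity-23954), line `taylor-model` — v3 read-outs, K-SIDE part 3b: the LANDING-DERIVATIVE
# bound (R11), face-wise (typer g32; semantic clause (R11) of ns-tm-g4 g3's `…VReadoutsDefs` p625517; the face formula of
# cert-1 g2 `LANDING-R11-FORMULA-cert1.md` 1daf851c0a89d484 in DIRECT form — faces used only as given constraints, no `Π` products)

For a stage `j` landing in ball `J`: the read-out derivative along a polytope direction `ζ` is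
`ℓ_{J,l}(landD y v (secCorr y (V ζ))) = ⟨c_l, ζ⟩` with the real row `c_l = w_{J,l}ᵀ · dl(y,v) · ps(y) · V` — `dl` the window Jacobian
of the landing map (`landDF`, `wv_landDF`), `ps` the section projector `I − F σᵀ/σ(F)` (`secCorrF`, `wv_secCorrF`). The checker
encloses `M := [DL]·[PS]·[V]` once per stage (`mulII` of `…IntervalDMatrix`), the row `c_l ∈ covMulIM W_l M`, subtracts the
PARTNER row box `G_l` (a face of ball `j`, `|⟨g_l, ζ⟩| ≤ rP_l` on the polytope) and bounds the rest on the box `|ζ_c| ≤ ρ_c`: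

  `testR11`:  `rP_l↑ + (Σ_c mag(c_l ⊖ G_l)_c · ρ_c)↑ ≤ β_l↓`  for every face `l < nF`;
  `testR11_sound`: then `|Σ_a φ(w_{l,a}) · wv (landDF Lv y v (secCorrF wσ q z)) a| ≤ β_l` for all `y ∈ Y` (sign-definite `y_{i₀1}`),
  tails `|v i| ≤ tv`, `q` with `wv q ∈ F` (take `q := Qb y y`, `F := qBboxMA(Y,Y)`), real matrices `vm ∈ [V]`, and directions
  `ζ` obeying the partner-face and box constraints, where `wv z b = Σ_c vm b c ζ_c` (`z = kapp V ζ` on the composer's side).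

* `CertTables.landDF` (`landD_eq_landDF`), `dlA/dlB/dlMat` + `wv_landDF` (the Jacobian identity), `dlBox` + `memMat_dlBox`;
* `CertTables.secCorrF` (`secCorr` with `σf := covR φ wσ`), `psMat` + `wv_secCorrF`, `psBox` + `memMat_psBox`;
* `IntervalD.sum_pick`, `CertTables.bilin_eq_row` (re-association `Σ_a w_a Σ_c m_{ac} ζ_c = Σ_c (wᵀm)_c ζ_c`), `abs_row_le`
  (`|⟨c,ζ⟩| ≤ rP + Σ mag(c ⊖ g)·ρ`), `testR11`, `testR11_sound`.

HONEST FRAMING: kernel bookkeeping for the MODEL certificate №23954 (rung TL-M3); nothing here is a statement about the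
Navier–Stokes equations.
-/

-- the sub-problem namespace repeats the summit name by design (D-0017)
set_option linter.dupNamespace false

namespace Summit.NavierStokesRegularity.NavierStokesRegularity.Theorems.TaylorModelCert

open scoped BigOperators
open Set
open Literature.Analysis.FluidPDE.TaoCascade Literature.Analysis.FluidPDE.TaoCascade.TaylorChain

namespace IntervalD

/-- A one-point indicator sum. [folklore] -/
theorem sum_pick {n t : ℕ} (ht : t < n) (A : ℝ) (w : ℕ → ℝ) :
    ∑ c ∈ Finset.range n, (if c = t then A else 0) * w c = A * w t := by
  rw [Finset.sum_eq_single t]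
  · simp
  · intro c _ hct; simp [hct]
  · intro h; exact absurd (Finset.mem_range.2 ht) h

/-- The sign of a sign-definite interval, as an interval `[±1, ±1]`. [folklore] -/
def signBox (I : IntervalD) : IntervalD := if posLo I then ofInt 1 else ofInt (-1)

/-- [folklore] -/
theorem mem_sign_signBox {x : ℝ} {I : IntervalD} (hs : signDef I = true) (hx : mem x I) : mem (Real.sign x) (signBox I) := by
  unfold signBox
  by_cases hp : posLo I = true
  · rw [if_pos hp]
    have h0 : 0 < I.lo.toReal := by simpa [posLo, Dyad.blt_iff] using hp
    rw [Real.sign_of_pos (lt_of_lt_of_le h0 hx.1)]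
    simpa using mem_ofInt 1
  · rw [if_neg hp]
    have hn : negHi I = true := by simpa [signDef, hp] using hs
    have h0 : I.hi.toReal < 0 := by simpa [negHi, Dyad.blt_iff] using hn
    rw [Real.sign_of_neg (lt_of_le_of_lt hx.2 h0)]
    simpa using mem_ofInt (-1)

end IntervalD

namespace CertTables

variable {K : Type} [Field K] {φ : K →+* ℝ} (T : CertTables K)

/-! ### The landing Jacobian -/

/-- The landing derivative `landD` as an explicit window function of the factor `Lv` (`landD_eq_landDF`). [folklore] -/
noncomputable def landDF (Lv : ℝ) (y : Fin 4 → ℤ → ℝ) (v : Fin 4 → ℝ) (z : Fin 4 → ℤ → ℝ) : Fin 4 → ℤ → ℝ :=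
  fun i k => Lv * ((if k + 1 ≤ T.Ka then z i (1 + k) else 0) / |y T.i₀ 1| -
    (if k + 1 ≤ T.Ka then y i (1 + k) else v i) * (Real.sign (y T.i₀ 1) * z T.i₀ 1) / (y T.i₀ 1) ^ 2)

/-- [folklore] -/
theorem landD_eq_landDF (j : ℕ) : (T.toCertData φ).landD j = T.landDF ((T.toCertData φ).Lv ((T.toCertData φ).nx j)) := rfl

/-- Numerator of the landing map at window coordinate `c` (real). [folklore] -/
noncomputable def numR (y : Fin 4 → ℤ → ℝ) (v : Fin 4 → ℝ) (c : ℕ) : ℝ :=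
  if T.wk c + 1 ≤ T.Ka then y (T.wi c) (1 + T.wk c) else v (T.wi c)

/-- Shift part of the landing Jacobian (real): `δ_{c', c+1}·[k+1 ≤ Ka]·|y₀|⁻¹`. [folklore] -/
noncomputable def dlA (y : Fin 4 → ℤ → ℝ) (c c' : ℕ) : ℝ :=
  if c' = c + 1 then (if T.wk c + 1 ≤ T.Ka then |y T.i₀ 1|⁻¹ else 0) else 0

/-- Column-`(i₀,1)` part of the landing Jacobian (real): `δ_{c', c₀}·num_c·sign(y₀)·(y₀²)⁻¹`. [folklore] -/
noncomputable def dlB (y : Fin 4 → ℤ → ℝ) (v : Fin 4 → ℝ) (c c' : ℕ) : ℝ :=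
  if c' = T.idx T.i₀ 1 then T.numR y v c * Real.sign (y T.i₀ 1) * ((y T.i₀ 1) ^ 2)⁻¹ else 0

/-- The landing Jacobian in window coordinates (real matrix). [folklore] -/
noncomputable def dlMat (Lv : ℝ) (y : Fin 4 → ℤ → ℝ) (v : Fin 4 → ℝ) (c c' : ℕ) : ℝ := Lv * (T.dlA y c c' - T.dlB y v c c')

omit [Field K] in
/-- **The Jacobian identity**: `wv (landDF Lv y v z) c = Σ_{c'<n} dlMat c c' · wv z c'` for every window coordinate `c`
(needs shell `1` in the window). [folklore] -/
theorem wv_landDF (h1 : -T.Kb ≤ 1 ∧ (1 : ℤ) ≤ T.Ka) (Lv : ℝ) (y : Fin 4 → ℤ → ℝ) (v : Fin 4 → ℝ) (z : Fin 4 → ℤ → ℝ)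
    {c : ℕ} (hc : c < T.n) :
    T.wv (T.landDF Lv y v z) c = ∑ c' ∈ Finset.range T.n, T.dlMat Lv y v c c' * T.wv z c' := by
  have hk := T.InW_wk hc
  have hc0 : T.idx T.i₀ 1 < T.n := T.idx_lt_n T.i₀ h1
  -- split the sum
  have hsplit : ∑ c' ∈ Finset.range T.n, T.dlMat Lv y v c c' * T.wv z c'
      = Lv * (∑ c' ∈ Finset.range T.n, T.dlA y c c' * T.wv z c' - ∑ c' ∈ Finset.range T.n, T.dlB y v c c' * T.wv z c') := by
    simp only [dlMat, Finset.mul_sum, ← Finset.sum_sub_distrib]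
    refine Finset.sum_congr rfl fun c' _ => by ring
  rw [hsplit]
  -- the B part
  have hB : ∑ c' ∈ Finset.range T.n, T.dlB y v c c' * T.wv z c'
      = T.numR y v c * Real.sign (y T.i₀ 1) * ((y T.i₀ 1) ^ 2)⁻¹ * z T.i₀ 1 := by
    unfold dlB
    rw [IntervalD.sum_pick hc0, T.wv_idx z T.i₀ h1]
  -- the A part
  have hA : ∑ c' ∈ Finset.range T.n, T.dlA y c c' * T.wv z c'
      = (if T.wk c + 1 ≤ T.Ka then z (T.wi c) (1 + T.wk c) / |y T.i₀ 1| else 0) := by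
    unfold dlA
    by_cases hK : T.wk c + 1 ≤ T.Ka
    · have hk' : -T.Kb ≤ 1 + T.wk c ∧ 1 + T.wk c ≤ T.Ka := ⟨by linarith [hk.1], by linarith⟩
      have ht : c + 1 < T.n := by
        have := T.idx_lt_n (T.wi c) hk'
        rwa [T.idx_one_add _ hk.1, T.idx_wi_wk hc] at this
      rw [IntervalD.sum_pick ht, if_pos hK, if_pos hK]
      have hw : T.wv z (c + 1) = z (T.wi c) (1 + T.wk c) := by
        have := T.wv_idx z (T.wi c) hk'
        rwa [T.idx_one_add _ hk.1, T.idx_wi_wk hc] at this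
      rw [hw, div_eq_inv_mul]
    · rw [if_neg hK]
      simp [hK]
  rw [hA, hB]
  simp only [wv, landDF, numR]
  by_cases hK : T.wk c + 1 ≤ T.Ka
  · simp only [if_pos hK]; ring
  · simp only [if_neg hK]; ring

/-- **Interval landing Jacobian** `[DL]`: entry `(c, c')` = `LvB·(A ⊖ B)` with `A := [c' = c+1 ∧ k+1 ≤ Ka]·[1/|y₀|]`,
`B := [c' = c₀]·[num_c]·[sign y₀]·[1/|y₀|]²`. [folklore] -/
def dlBox (prec : ℕ) (LvB : IntervalD) (tv : Dyad) (Y : Array IntervalD) : Array (Array IntervalD) :=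
  let Y0 := IntervalD.aget Y (T.idx T.i₀ 1)
  let R := IntervalD.invPos prec (IntervalD.absBox Y0)
  let R2 := IntervalD.mulR prec R R
  let Sg := IntervalD.signBox Y0
  Array.ofFn fun c : Fin T.n => Array.ofFn fun c' : Fin T.n =>
    IntervalD.mulR prec LvB (IntervalD.subR prec
      (if (c' : ℕ) = c + 1 then (if T.wk c + 1 ≤ T.Ka then R else IntervalD.ofInt 0) else IntervalD.ofInt 0)
      (if (c' : ℕ) = T.idx T.i₀ 1 then IntervalD.mulR prec (IntervalD.mulR prec (T.landNum tv Y c) Sg) R2 else IntervalD.ofInt 0))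

omit [Field K] in
/-- **`dlMat ∈ dlBox`** for `y ∈ Y` (window values, `landOK Y`), tails `|v i| ≤ tv`, `Lv ∈ LvB`. [folklore] -/
theorem memMat_dlBox {Y : Array IntervalD} (hok : T.landOK Y = true) (prec : ℕ) {Lv : ℝ} {LvB : IntervalD}
    (hLv : IntervalD.mem Lv LvB) {tv : Dyad} {v : Fin 4 → ℝ} (hv : ∀ i, |v i| ≤ tv.toReal)
    {y : Fin 4 → ℤ → ℝ} (hy : MemVec T.n (T.wv y) Y) :
    MemMat T.n (T.dlMat Lv y v) (T.dlBox prec LvB tv Y) := by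
  simp only [landOK, Bool.and_eq_true, decide_eq_true_eq] at hok
  obtain ⟨h1, hsd⟩ := hok
  have hy0 : IntervalD.mem (y T.i₀ 1) (IntervalD.aget Y (T.idx T.i₀ 1)) := by
    have := hy (T.idx T.i₀ 1) (T.idx_lt_n T.i₀ h1); rwa [T.wv_idx y T.i₀ h1] at this
  have habs := IntervalD.mem_abs_absBox hsd hy0
  have hR := IntervalD.mem_invPos prec (IntervalD.absBox_lo_pos hsd) habs
  have hR2 : IntervalD.mem (((y T.i₀ 1) ^ 2)⁻¹)
      (IntervalD.mulR prec (IntervalD.invPos prec (IntervalD.absBox (IntervalD.aget Y (T.idx T.i₀ 1))))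
        (IntervalD.invPos prec (IntervalD.absBox (IntervalD.aget Y (T.idx T.i₀ 1))))) := by
    have e : ((y T.i₀ 1) ^ 2)⁻¹ = |y T.i₀ 1|⁻¹ * |y T.i₀ 1|⁻¹ := by rw [← sq_abs, sq, mul_inv]
    rw [e]; exact IntervalD.mem_mulR prec hR hR
  have hSg := IntervalD.mem_sign_signBox hsd hy0
  intro c hc c' hc'
  have hk := T.InW_wk hc
  have hnum : IntervalD.mem (T.numR y v c) (T.landNum tv Y c) := by
    unfold numR landNum
    by_cases hK : T.wk c + 1 ≤ T.Ka
    · rw [if_pos hK, if_pos hK]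
      have hk' : -T.Kb ≤ 1 + T.wk c ∧ 1 + T.wk c ≤ T.Ka := ⟨by linarith [hk.1], by linarith⟩
      have := hy (T.idx (T.wi c) (1 + T.wk c)) (T.idx_lt_n _ hk')
      rw [T.wv_idx y _ hk', T.idx_one_add _ hk.1, T.idx_wi_wk hc] at this
      exact this
    · rw [if_neg hK, if_neg hK]
      exact IntervalD.mem_symBox (hv _)
  unfold dlBox
  simp only [imget_ofFn_row _ c' hc, IntervalD.aget_ofFn _ hc']
  refine IntervalD.mem_mulR prec hLv (IntervalD.mem_subR prec ?_ ?_)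
  · unfold dlA
    by_cases he : c' = c + 1
    · simp only [he, if_true]
      by_cases hK : T.wk c + 1 ≤ T.Ka
      · simp only [if_pos hK]; exact hR
      · simp only [if_neg hK]; simpa using IntervalD.mem_ofInt 0
    · simp only [he, if_false]; simpa using IntervalD.mem_ofInt 0
  · unfold dlB
    by_cases he : c' = T.idx T.i₀ 1
    · simp only [he, if_true]
      exact IntervalD.mem_mulR prec (IntervalD.mem_mulR prec hnum hSg) hR2
    · simp only [he, if_false]; simpa using IntervalD.mem_ofInt 0

/-! ### The section projector -/

/-- `secCorr` with the section functional `covR φ wσ` and the field value `q` (`= Qb y y`) as explicit data. [folklore] -/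
noncomputable def secCorrF (φ : K →+* ℝ) (wσ : List K) (q z : Fin 4 → ℤ → ℝ) : Fin 4 → ℤ → ℝ :=
  z - (T.covR φ wσ z / T.covR φ wσ q) • q

/-- The section projector in window coordinates (real matrix): `δ_{ab} − F_a·σ_b / gd`. [folklore] -/
noncomputable def psMat (φ : K →+* ℝ) (wσ : List K) (q : Fin 4 → ℤ → ℝ) (a b : ℕ) : ℝ :=
  (if b = a then 1 else 0) - T.wv q a * φ (vget wσ b) * (T.covR φ wσ q)⁻¹

/-- **The projector identity**: `wv (secCorrF wσ q z) a = Σ_{b<n} psMat a b · wv z b`. [folklore] -/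
theorem wv_secCorrF (wσ : List K) (q z : Fin 4 → ℤ → ℝ) {a : ℕ} (ha : a < T.n) :
    T.wv (T.secCorrF φ wσ q z) a = ∑ b ∈ Finset.range T.n, T.psMat φ wσ q a b * T.wv z b := by
  have hsum : ∑ b ∈ Finset.range T.n, T.psMat φ wσ q a b * T.wv z b
      = ∑ b ∈ Finset.range T.n, (if b = a then (1:ℝ) else 0) * T.wv z b
        - T.wv q a * (T.covR φ wσ q)⁻¹ * ∑ b ∈ Finset.range T.n, φ (vget wσ b) * T.wv z b := by
    simp only [psMat, sub_mul, Finset.sum_sub_distrib, Finset.mul_sum]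
    refine congrArg₂ _ rfl (Finset.sum_congr rfl fun b _ => by ring)
  rw [hsum, IntervalD.sum_pick ha, ← T.covR_apply φ wσ z]
  simp only [secCorrF, wv, Pi.sub_apply, Pi.smul_apply, smul_eq_mul]
  rw [div_eq_mul_inv]; ring

/-- **Interval section projector** `[PS]`: entry `(a,b) = δ_{ab} ⊖ F_a·Wσ_b·[1/gd]`, `gd := dotR Wσ F`. [folklore] -/
def psBox (prec : ℕ) (Wσ F : Array IntervalD) : Array (Array IntervalD) :=
  let G := IntervalD.invPos prec (IntervalD.rangeSumR prec (fun b => IntervalD.mulR prec (IntervalD.aget Wσ b) (IntervalD.aget F b)) T.n)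
  Array.ofFn fun a : Fin T.n => Array.ofFn fun b : Fin T.n =>
    IntervalD.subR prec (if (b : ℕ) = a then IntervalD.ofInt 1 else IntervalD.ofInt 0)
      (IntervalD.mulR prec (IntervalD.mulR prec (IntervalD.aget F a) (IntervalD.aget Wσ b)) G)

/-- Positivity test of the section denominator box `gd = dotR Wσ F`. [folklore] -/
def psOK (prec : ℕ) (Wσ F : Array IntervalD) : Bool :=
  IntervalD.posLo (IntervalD.rangeSumR prec (fun b => IntervalD.mulR prec (IntervalD.aget Wσ b) (IntervalD.aget F b)) T.n)

/-- **`psMat ∈ psBox`** when `φ(wσ_b) ∈ Wσ[b]`, `wv q ∈ F`, and `psOK`. [folklore] -/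
theorem memMat_psBox (prec : ℕ) {wσ : List K} {Wσ : Array IntervalD}
    (hW : ∀ b < T.n, IntervalD.mem (φ (vget wσ b)) (IntervalD.aget Wσ b)) {q : Fin 4 → ℤ → ℝ} {F : Array IntervalD}
    (hq : MemVec T.n (T.wv q) F) (hok : T.psOK prec Wσ F = true) :
    MemMat T.n (T.psMat φ wσ q) (T.psBox prec Wσ F) := by
  have hgd : IntervalD.mem (T.covR φ wσ q)
      (IntervalD.rangeSumR prec (fun b => IntervalD.mulR prec (IntervalD.aget Wσ b) (IntervalD.aget F b)) T.n) := by
    rw [T.covR_apply φ wσ q]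
    exact IntervalD.mem_rangeSumR prec T.n fun b hb => IntervalD.mem_mulR prec (hW b hb) (hq b hb)
  have h0 : 0 < (IntervalD.rangeSumR prec (fun b => IntervalD.mulR prec (IntervalD.aget Wσ b) (IntervalD.aget F b)) T.n).lo.toReal := by
    simpa [psOK, IntervalD.posLo, Dyad.blt_iff] using hok
  have hG := IntervalD.mem_invPos prec h0 hgd
  intro a ha b hb
  unfold psBox
  simp only [imget_ofFn_row _ b ha, IntervalD.aget_ofFn _ hb]
  unfold psMat
  refine IntervalD.mem_subR prec ?_ (IntervalD.mem_mulR prec (IntervalD.mem_mulR prec (hq a ha) (hW b hb)) hG)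
  by_cases he : b = a
  · simp only [he, if_true]; simpa using IntervalD.mem_ofInt 1
  · simp only [he, if_false]; simpa using IntervalD.mem_ofInt 0

/-! ### Re-association and the face bound -/

omit [Field K] in
/-- Bilinear re-association: `Σ_a w_a · (Σ_c m_{ac} ζ_c) = Σ_c (Σ_a w_a m_{ac}) ζ_c`. [folklore] -/
theorem bilin_eq_row (n : ℕ) (w : ℕ → ℝ) (m : ℕ → ℕ → ℝ) (ζ : ℕ → ℝ) :
    ∑ a ∈ Finset.range n, w a * ∑ c ∈ Finset.range n, m a c * ζ c
      = ∑ c ∈ Finset.range n, (∑ a ∈ Finset.range n, w a * m a c) * ζ c := by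
  simp only [Finset.mul_sum, Finset.sum_mul]
  rw [Finset.sum_comm]
  refine Finset.sum_congr rfl fun c _ => Finset.sum_congr rfl fun a _ => by ring

omit [Field K] in
/-- Triple product re-association: `Σ_b d_{ab} Σ_{b'} p_{bb'} Σ_c v_{b'c} ζ_c = Σ_c (Σ_{b'} (Σ_b d_{ab} p_{bb'}) v_{b'c}) ζ_c`. [folklore] -/
theorem triple_eq_row (n : ℕ) (d p v : ℕ → ℕ → ℝ) (ζ : ℕ → ℝ) (a : ℕ) :
    ∑ b ∈ Finset.range n, d a b * ∑ b' ∈ Finset.range n, p b b' * ∑ c ∈ Finset.range n, v b' c * ζ c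
      = ∑ c ∈ Finset.range n, (∑ b' ∈ Finset.range n, (∑ b ∈ Finset.range n, d a b * p b b') * v b' c) * ζ c := by
  have inner : ∀ b ∈ Finset.range n, d a b * ∑ b' ∈ Finset.range n, p b b' * ∑ c ∈ Finset.range n, v b' c * ζ c
      = ∑ c ∈ Finset.range n, (∑ b' ∈ Finset.range n, d a b * p b b' * v b' c) * ζ c := by
    intro b _
    rw [Finset.mul_sum]
    have : ∑ b' ∈ Finset.range n, d a b * (p b b' * ∑ c ∈ Finset.range n, v b' c * ζ c)
        = ∑ b' ∈ Finset.range n, (d a b * p b b') * ∑ c ∈ Finset.range n, v b' c * ζ c :=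
      Finset.sum_congr rfl fun b' _ => by ring
    rw [this, bilin_eq_row]
  rw [Finset.sum_congr rfl inner, Finset.sum_comm]
  refine Finset.sum_congr rfl fun c _ => ?_
  rw [← Finset.sum_mul]
  congr 1
  rw [Finset.sum_comm]
  refine Finset.sum_congr rfl fun b' _ => ?_
  rw [Finset.sum_mul]

omit [Field K] in
/-- **Face bound**: `|⟨c, ζ⟩| ≤ rP + Σ_c mag(C ⊖ G)_c · ρ_c` when `c ∈ C`, `g ∈ G`, `|⟨g, ζ⟩| ≤ rP`, `|ζ_c| ≤ ρ_c`. [folklore] -/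
theorem abs_row_le {n : ℕ} (prec : ℕ) {C G : Array IntervalD} {cr g : ℕ → ℝ} (hC : ∀ c < n, IntervalD.mem (cr c) (IntervalD.aget C c))
    (hG : ∀ c < n, IntervalD.mem (g c) (IntervalD.aget G c)) {ζ : ℕ → ℝ} {ρ : Array Dyad} (hρ : ∀ c < n, |ζ c| ≤ (dget ρ c).toReal)
    {rP : ℝ} (hface : |∑ c ∈ Finset.range n, g c * ζ c| ≤ rP) :
    |∑ c ∈ Finset.range n, cr c * ζ c| ≤ rP +
      (IntervalD.rangeSumR prec (fun c => IntervalD.mulR prec (IntervalD.ofDyad (IntervalD.mag (IntervalD.subR prec (IntervalD.aget C c) (IntervalD.aget G c))))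
        (IntervalD.ofDyad (dget ρ c))) n).hi.toReal := by
  have hsplit : ∑ c ∈ Finset.range n, cr c * ζ c = ∑ c ∈ Finset.range n, g c * ζ c + ∑ c ∈ Finset.range n, (cr c - g c) * ζ c := by
    rw [← Finset.sum_add_distrib]; refine Finset.sum_congr rfl fun c _ => by ring
  rw [hsplit]
  refine le_trans (abs_add_le _ _) (add_le_add hface ?_)
  refine le_trans (Finset.abs_sum_le_sum_abs _ _) ?_
  have hmem : IntervalD.mem (∑ c ∈ Finset.range n, (IntervalD.mag (IntervalD.subR prec (IntervalD.aget C c) (IntervalD.aget G c))).toReal * (dget ρ c).toReal)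
      (IntervalD.rangeSumR prec (fun c => IntervalD.mulR prec (IntervalD.ofDyad (IntervalD.mag (IntervalD.subR prec (IntervalD.aget C c) (IntervalD.aget G c))))
        (IntervalD.ofDyad (dget ρ c))) n) :=
    IntervalD.mem_rangeSumR prec n fun c _ => IntervalD.mem_mulR prec (IntervalD.mem_ofDyad _) (IntervalD.mem_ofDyad _)
  refine le_trans ?_ hmem.2
  refine Finset.sum_le_sum fun c hc => ?_
  have hc' := Finset.mem_range.1 hc
  rw [abs_mul]
  have hmag := IntervalD.abs_le_mag (IntervalD.mem_subR prec (hC c hc') (hG c hc'))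
  exact mul_le_mul hmag (hρ c hc') (abs_nonneg _) (le_trans (abs_nonneg _) hmag)

/-! ### (R11) test and soundness -/

/-- **(R11) TEST** per face `l < nF` of ball `J`: with `M := [DL]·[PS]·[V]`, row `C_l := W_l·M`, partner row box `G_l`, partner radius
`rP_l`, box radii `ρ`: `rP_l.hi + (Σ_c mag(C_l ⊖ G_l)_c·ρ_c).hi ≤ β_l.lo`; plus the structural tests `landOK`, `psOK`. [folklore] -/
def testR11 (prec nF : ℕ) (W G : Array (Array IntervalD)) (rPB βB : Array IntervalD) (ρ : Array Dyad)
    (LvB : IntervalD) (tv : Dyad) (Y Wσ F : Array IntervalD) (VB : Array (Array IntervalD)) : Bool :=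
  let M := mulII T.n prec (mulII T.n prec (T.dlBox prec LvB tv Y) (T.psBox prec Wσ F)) VB
  T.landOK Y && T.psOK prec Wσ F &&
  allN nF fun l =>
    let C := IntervalD.covMulIM T.n prec (IntervalD.lget W l) M
    let Gl := IntervalD.lget G l
    Dyad.ble
      (Dyad.add (IntervalD.aget rPB l).hi
        (IntervalD.rangeSumR prec (fun c => IntervalD.mulR prec
          (IntervalD.ofDyad (IntervalD.mag (IntervalD.subR prec (IntervalD.aget C c) (IntervalD.aget Gl c)))) (IntervalD.ofDyad (dget ρ c))) T.n).hi)
      (IntervalD.aget βB l).lo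

/-- **Soundness of (R11)** in coordinates (see the module docstring for the reading of each hypothesis). [folklore] -/
theorem testR11_sound {prec nF : ℕ} {W G : Array (Array IntervalD)} {rPB βB : Array IntervalD} {ρ : Array Dyad}
    {LvB : IntervalD} {tv : Dyad} {Y Wσ F : Array IntervalD} {VB : Array (Array IntervalD)}
    (h : T.testR11 prec nF W G rPB βB ρ LvB tv Y Wσ F VB = true)
    {w : ℕ → List K} (hW : ∀ l < nF, ∀ a < T.n, IntervalD.mem (φ (vget (w l) a)) (IntervalD.aget (IntervalD.lget W l) a))
    {g : ℕ → ℕ → ℝ} (hG : ∀ l < nF, ∀ c < T.n, IntervalD.mem (g l c) (IntervalD.aget (IntervalD.lget G l) c))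
    {rP β : ℕ → ℝ} (hrP : ∀ l < nF, IntervalD.mem (rP l) (IntervalD.aget rPB l)) (hβ : ∀ l < nF, IntervalD.mem (β l) (IntervalD.aget βB l))
    {Lv : ℝ} (hLv : IntervalD.mem Lv LvB) {v : Fin 4 → ℝ} (hv : ∀ i, |v i| ≤ tv.toReal)
    {y : Fin 4 → ℤ → ℝ} (hy : MemVec T.n (T.wv y) Y)
    {wσ : List K} (hWσ : ∀ b < T.n, IntervalD.mem (φ (vget wσ b)) (IntervalD.aget Wσ b))
    {q : Fin 4 → ℤ → ℝ} (hq : MemVec T.n (T.wv q) F)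
    {vm : ℕ → ℕ → ℝ} (hV : MemMat T.n vm VB)
    {ζ : ℕ → ℝ} (hρ : ∀ c < T.n, |ζ c| ≤ (dget ρ c).toReal)
    (hface : ∀ l < nF, |∑ c ∈ Finset.range T.n, g l c * ζ c| ≤ rP l)
    {z : Fin 4 → ℤ → ℝ} (hz : ∀ b < T.n, T.wv z b = ∑ c ∈ Finset.range T.n, vm b c * ζ c)
    {l : ℕ} (hl : l < nF) :
    |∑ a ∈ Finset.range T.n, φ (vget (w l) a) * T.wv (T.landDF Lv y v (T.secCorrF φ wσ q z)) a| ≤ β l := by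
  unfold testR11 at h
  simp only [Bool.and_eq_true] at h
  obtain ⟨⟨hok, hps⟩, hall⟩ := h
  have h1 : -T.Kb ≤ 1 ∧ (1 : ℤ) ≤ T.Ka := by
    have := hok; simp only [landOK, Bool.and_eq_true, decide_eq_true_eq] at this; exact this.1
  have hb := (allN_eq_true.1 hall) l hl
  simp only [Dyad.ble_iff, Dyad.toReal_add] at hb
  -- the real matrices
  have hDL := T.memMat_dlBox hok prec hLv hv hy
  have hPS := T.memMat_psBox prec hWσ hq hps
  have hM := memMat_mulII prec (memMat_mulII prec hDL hPS) hV
  -- the identity: the read-out derivative is ⟨row, ζ⟩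
  have hcoord : ∀ a < T.n, T.wv (T.landDF Lv y v (T.secCorrF φ wσ q z)) a
      = ∑ c ∈ Finset.range T.n,
          (∑ b' ∈ Finset.range T.n, (∑ b ∈ Finset.range T.n, T.dlMat Lv y v a b * T.psMat φ wσ q b b') * vm b' c) * ζ c := by
    intro a ha
    rw [T.wv_landDF h1 Lv y v _ ha]
    have : ∑ c' ∈ Finset.range T.n, T.dlMat Lv y v a c' * T.wv (T.secCorrF φ wσ q z) c'
        = ∑ b ∈ Finset.range T.n, T.dlMat Lv y v a b * ∑ b' ∈ Finset.range T.n, T.psMat φ wσ q b b' * ∑ c ∈ Finset.range T.n, vm b' c * ζ c := by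
      refine Finset.sum_congr rfl fun b hb' => ?_
      rw [T.wv_secCorrF wσ q z (Finset.mem_range.1 hb')]
      congr 1
      exact Finset.sum_congr rfl fun b' hb'' => by rw [hz b' (Finset.mem_range.1 hb'')]
    rw [this, triple_eq_row]
  have hrow : ∑ a ∈ Finset.range T.n, φ (vget (w l) a) * T.wv (T.landDF Lv y v (T.secCorrF φ wσ q z)) a
      = ∑ c ∈ Finset.range T.n, (∑ a ∈ Finset.range T.n, φ (vget (w l) a) *
          (∑ b' ∈ Finset.range T.n, (∑ b ∈ Finset.range T.n, T.dlMat Lv y v a b * T.psMat φ wσ q b b') * vm b' c)) * ζ c := by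
    rw [← bilin_eq_row]
    exact Finset.sum_congr rfl fun a ha => by rw [hcoord a (Finset.mem_range.1 ha)]
  rw [hrow]
  have hC := fun c (hc : c < T.n) => IntervalD.mem_covMulIM prec (hW l hl) hM hc
  have hbound := abs_row_le prec hC (hG l hl) hρ (hface l hl)
  exact le_trans hbound (le_trans (by linarith [(hrP l hl).2]) (le_trans hb (hβ l hl).1))

end CertTables

end Summit.NavierStokesRegularity.NavierStokesRegularity.Theorems.TaylorModelCert
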